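import Summits.AtomisticToContinuum.Crystallization.Theses.ChessboardParticlePlanes
import Literature.Algebra.EuclideanLattices.GaussianLatticeSums
import Literature.Analysis.FunctionSpaces.BesselKMellin
import Literature.Analysis.FunctionSpaces.BesselKHalf
import Mathlib.Analysis.SpecialFunctions.Gaussian.FourierTransform
import Mathlib.MeasureTheory.Integral.Prod

/-!
# Crux `ChessboardParticlePlanes.LjPlaneChessboard` (stmt-AtomisticToContinuum-6709), line `Sketch`,
# stub `stub_yukawaSliceFourier` — the Sommerfeld–Weyl transform of a planar Yukawa slice

For a `2`-dimensional real inner-product space `V`, `m > 0`, `u > 0` and `x ∈ V`, the Fourier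
transform (Mathlib's `𝓕`, kernel `𝐞(-⟪v, w⟫) = e^{-2πi⟪v, w⟫}`) of the planar slice
`v ↦ e^{-m√(‖v-x‖²+u²)}/√(‖v-x‖²+u²)` of the Yukawa potential at height `u` is
`𝐞(-⟪x, w⟫) · 2π e^{-u√(m²+(2π‖w‖)²)}/√(m²+(2π‖w‖)²)` — the classical Sommerfeld–Weyl identity
`∫_{ℝ²} e^{-2πi q·ρ} e^{-m√(ρ²+u²)}/√(ρ²+u²) d²ρ = 2π e^{-u√(m²+4π²q²)}/√(m²+4π²q²)`, the
analytic input of the planar mode expansion (Poisson summation) of the chessboard estimate.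

Route (inside Mathlib + the tree, no named facts):
* translation (`VectorFourier.fourierIntegral_comp_add_right`) reduces to `x = 0`;
* Gaussian subordination `e^{-mR}/R = π^{-1/2} ∫₀^∞ t^{-1/2} e^{-R²t - m²/(4t)} dt`
  (`yukawaFT_subordination`), from the tree's Laplace-type integral
  `∫₀^∞ t^{μ-1} e^{-At-B/t} dt = 2 (√(B/A))^μ K_μ(2√(AB))`
  (`Literature.Analysis.FunctionSpaces.integral_rpow_mul_exp_neg_mul_sub_div`) and
  `K_{1/2}(x) = √(π/(2x)) e^{-x}` (`besselK_half_ofReal`): `yukawaFT_laplace_half`,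
  `yukawaFT_laplace_neg_half` are the two classical special cases `μ = ± 1/2`;
* Fubini (`MeasureTheory.integral_integral_swap`; the integrand is absolutely integrable on
  `V × (0, ∞)` because `∫_V e^{-t‖v‖²} dv = π/t` and `t^{-3/2} e^{-u²t - m²/(4t)}` is integrable,
  `yukawaFT_integrable_prod`);
* the Gaussian transform `𝓕[e^{-t‖·‖²}](w) = (π/t) e^{-π²‖w‖²/t}` in dimension `2`
  (`fourier_gaussian_innerProductSpace`), `yukawaFT_inner`;
* the remaining `t`-integral is the case `μ = -1/2`:
  `π^{1/2} ∫₀^∞ t^{-3/2} e^{-u²t - (m²+4π²‖w‖²)/(4t)} dt = 2π e^{-uκ}/κ`, `κ = √(m²+(2π‖w‖)²)`.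

Main results:
* `yukawaFT_fourier_zero` : the transform of the centred slice (`x = 0`);
* `stub_yukawaSliceFourier` : the registered stub (general centre `x`).
[folklore; Sommerfeld 1909 / Weyl 1919 angular-spectrum identity]
-/

noncomputable section

namespace Summit.AtomisticToContinuum.Crystallization.Theorems.ChessboardParticlePlanesLjPlaneChessboard

open MeasureTheory Set Complex
open Literature.Analysis.FunctionSpaces
open scoped Real InnerProductSpace FourierTransform

/-! ## Two Laplace-type integrals (`μ = ± 1/2` of the tree's `K_μ` Mellin formula) -/

/-- The tree's Mellin formula in the variables `A = a²`, `B = b²`: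
`∫₀^∞ t^{μ-1} e^{-a²t-b²/t} dt = 2 (b/a)^μ Re K_μ(2ab)` (`a, b > 0`). [folklore] -/
theorem yukawaFT_laplace_aux {a b : ℝ} (ha : 0 < a) (hb : 0 < b) (μ : ℝ) :
    (∫ t in Ioi (0 : ℝ), t ^ (μ - 1) * Real.exp (-(a ^ 2 * t + b ^ 2 / t))) =
      2 * (b / a) ^ μ * (besselK μ ((2 * (a * b) : ℝ) : ℂ)).re := by
  obtain ⟨h, -⟩ := integral_rpow_mul_exp_neg_mul_sub_div (by positivity : 0 < a ^ 2)
    (by positivity : 0 < b ^ 2) μ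
  rw [h, show a ^ 2 * b ^ 2 = (a * b) ^ 2 by ring, Real.sqrt_sq (by positivity),
    show b ^ 2 / a ^ 2 = (b / a) ^ 2 by ring, Real.sqrt_sq (by positivity)]

/-- `∫₀^∞ t^{-1/2} e^{-At-B/t} dt = √(π/A) e^{-2√(AB)}` for `A, B > 0` (the case `μ = 1/2` of
`integral_rpow_mul_exp_neg_mul_sub_div`, with `K_{1/2}(x) = √(π/(2x)) e^{-x}`). [folklore] -/
theorem yukawaFT_laplace_half {A B : ℝ} (hA : 0 < A) (hB : 0 < B) :
    (∫ t in Ioi (0 : ℝ), t ^ ((1 / 2 : ℝ) - 1) * Real.exp (-(A * t + B / t))) =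
      Real.sqrt (π / A) * Real.exp (-(2 * Real.sqrt (A * B))) := by
  obtain ⟨a, ha, rfl⟩ : ∃ a, 0 < a ∧ a ^ 2 = A := ⟨_, Real.sqrt_pos.2 hA, Real.sq_sqrt hA.le⟩
  obtain ⟨b, hb, rfl⟩ : ∃ b, 0 < b ∧ b ^ 2 = B := ⟨_, Real.sqrt_pos.2 hB, Real.sq_sqrt hB.le⟩
  rw [yukawaFT_laplace_aux ha hb, show a ^ 2 * b ^ 2 = (a * b) ^ 2 by ring,
    Real.sqrt_sq (by positivity)]
  have hs : 0 < 2 * (a * b) := by positivity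
  have hK : besselK ((1 / 2 : ℝ) : ℂ) ((2 * (a * b) : ℝ) : ℂ) =
      ((Real.sqrt (π / (2 * (2 * (a * b)))) * Real.exp (-(2 * (a * b))) : ℝ) : ℂ) := by
    rw [← besselK_half_ofReal hs]
    norm_num
  rw [hK, Complex.ofReal_re]
  have key : 2 * (b / a) ^ (1 / 2 : ℝ) * Real.sqrt (π / (2 * (2 * (a * b)))) =
      Real.sqrt (π / a ^ 2) := by
    rw [← sq_eq_sq₀ (by positivity) (by positivity), mul_pow, mul_pow, ← Real.sqrt_eq_rpow,
      Real.sq_sqrt (by positivity), Real.sq_sqrt (by positivity), Real.sq_sqrt (by positivity)]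
    field_simp
  rw [← key]
  ring

/-- `∫₀^∞ t^{-3/2} e^{-At-B/t} dt = √(π/B) e^{-2√(AB)}` for `A, B > 0` (the case `μ = -1/2` of
`integral_rpow_mul_exp_neg_mul_sub_div`, with `K_{-1/2} = K_{1/2}`). [folklore] -/
theorem yukawaFT_laplace_neg_half {A B : ℝ} (hA : 0 < A) (hB : 0 < B) :
    (∫ t in Ioi (0 : ℝ), t ^ ((-(1 / 2) : ℝ) - 1) * Real.exp (-(A * t + B / t))) =
      Real.sqrt (π / B) * Real.exp (-(2 * Real.sqrt (A * B))) := by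
  obtain ⟨a, ha, rfl⟩ : ∃ a, 0 < a ∧ a ^ 2 = A := ⟨_, Real.sqrt_pos.2 hA, Real.sq_sqrt hA.le⟩
  obtain ⟨b, hb, rfl⟩ : ∃ b, 0 < b ∧ b ^ 2 = B := ⟨_, Real.sqrt_pos.2 hB, Real.sq_sqrt hB.le⟩
  rw [yukawaFT_laplace_aux ha hb, show a ^ 2 * b ^ 2 = (a * b) ^ 2 by ring,
    Real.sqrt_sq (by positivity)]
  have hs : 0 < 2 * (a * b) := by positivity
  have hK : besselK ((-(1 / 2) : ℝ) : ℂ) ((2 * (a * b) : ℝ) : ℂ) =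
      ((Real.sqrt (π / (2 * (2 * (a * b)))) * Real.exp (-(2 * (a * b))) : ℝ) : ℂ) := by
    rw [← besselK_half_ofReal hs, Complex.ofReal_neg, besselK_neg]
    norm_num
  rw [hK, Complex.ofReal_re]
  have key : 2 * (b / a) ^ (-(1 / 2) : ℝ) * Real.sqrt (π / (2 * (2 * (a * b)))) =
      Real.sqrt (π / b ^ 2) := by
    rw [Real.rpow_neg (by positivity), ← Real.sqrt_eq_rpow,
      ← sq_eq_sq₀ (by positivity) (by positivity), mul_pow, mul_pow, inv_pow,
      Real.sq_sqrt (by positivity), Real.sq_sqrt (by positivity), Real.sq_sqrt (by positivity)]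
    field_simp
  rw [← key]
  ring

/-! ## Gaussian subordination of the Yukawa slice and elementary bookkeeping -/

/-- **Gaussian subordination**: `e^{-m√A}/√A = π^{-1/2} ∫₀^∞ t^{-1/2} e^{-At - m²/(4t)} dt` for
`m, A > 0`. [folklore] -/
theorem yukawaFT_subordination {m A : ℝ} (hm : 0 < m) (hA : 0 < A) :
    Real.exp (-(m * Real.sqrt A)) / Real.sqrt A =
      ∫ t in Ioi (0 : ℝ), (Real.sqrt π)⁻¹ * (t ^ ((1 / 2 : ℝ) - 1) *
        Real.exp (-(A * t + (m ^ 2 / 4) / t))) := by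
  rw [integral_const_mul, yukawaFT_laplace_half hA (by positivity)]
  have h1 : Real.sqrt (A * (m ^ 2 / 4)) = Real.sqrt A * (m / 2) := by
    rw [Real.sqrt_mul' _ (by positivity), show m ^ 2 / 4 = (m / 2) ^ 2 by ring,
      Real.sqrt_sq (by positivity)]
  have hπ : 0 < Real.sqrt π := Real.sqrt_pos.2 Real.pi_pos
  have hA' : 0 < Real.sqrt A := Real.sqrt_pos.2 hA
  rw [h1, Real.sqrt_div' _ hA.le, show 2 * (Real.sqrt A * (m / 2)) = m * Real.sqrt A by ring]
  field_simp

/-- The weight bookkeeping `π^{-1/2} t^{-1/2} a · (π/t) = π^{1/2} t^{-3/2} a` (`t > 0`).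
[folklore] -/
theorem yukawaFT_weight_mul {t : ℝ} (ht : 0 < t) (a : ℝ) :
    (Real.sqrt π)⁻¹ * (t ^ ((1 / 2 : ℝ) - 1) * a) * (π / t) =
      Real.sqrt π * (t ^ ((-(1 / 2) : ℝ) - 1) * a) := by
  have hpow : t ^ ((-(1 / 2) : ℝ) - 1) = t ^ ((1 / 2 : ℝ) - 1) / t := by
    rw [show (-(1 / 2) : ℝ) - 1 = ((1 / 2 : ℝ) - 1) - 1 by norm_num, Real.rpow_sub_one ht.ne']
  have hπ : (Real.sqrt π)⁻¹ * π = Real.sqrt π := by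
    rw [inv_mul_eq_iff_eq_mul₀ (Real.sqrt_pos.2 Real.pi_pos).ne']
    exact (Real.mul_self_sqrt Real.pi_pos.le).symm
  rw [hpow]
  calc (Real.sqrt π)⁻¹ * (t ^ ((1 / 2 : ℝ) - 1) * a) * (π / t)
      = ((Real.sqrt π)⁻¹ * π) * (t ^ ((1 / 2 : ℝ) - 1) / t * a) := by ring
    _ = Real.sqrt π * (t ^ ((1 / 2 : ℝ) - 1) / t * a) := by rw [hπ]

/-- Splitting off the Gaussian factor: `e^{-((v²+u²)t + m²/(4t))} = e^{-(u²t + m²/(4t))} e^{-tv²}`.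
[folklore] -/
theorem yukawaFT_exp_split (v2 u m t : ℝ) :
    Real.exp (-((v2 + u ^ 2) * t + (m ^ 2 / 4) / t)) =
      Real.exp (-(u ^ 2 * t + (m ^ 2 / 4) / t)) * Real.exp (-(t * v2)) := by
  rw [← Real.exp_add]
  congr 1
  ring

variable {V : Type*} [NormedAddCommGroup V] [InnerProductSpace ℝ V] [FiniteDimensional ℝ V]
  [MeasurableSpace V] [BorelSpace V]

/-! ## Gaussian integrals in dimension two and the Fubini step -/

/-- `∫_V e^{-t‖v‖²} dv = π/t` in dimension `2` (`t > 0`). [folklore] -/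
theorem yukawaFT_integral_gaussian_two (hV : Module.finrank ℝ V = 2) {t : ℝ} (ht : 0 < t) :
    ∫ v : V, Real.exp (-(t * ‖v‖ ^ 2)) = π / t := by
  have h := GaussianFourier.integral_rexp_neg_mul_sq_norm (V := V) ht
  simp_rw [neg_mul] at h
  rw [h, hV]
  norm_num

/-- `v ↦ e^{-t‖v‖²}` is integrable on `V` (`t > 0`). [folklore] -/
theorem yukawaFT_integrable_gaussian {t : ℝ} (ht : 0 < t) :
    Integrable (fun v : V ↦ Real.exp (-(t * ‖v‖ ^ 2))) := by
  refine Integrable.of_integral_ne_zero ?_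
  have h := GaussianFourier.integral_rexp_neg_mul_sq_norm (V := V) ht
  simp_rw [neg_mul] at h
  rw [h]
  positivity

/-- The `V`-integral of the (non-negative) subordination integrand at fixed `t > 0`:
`∫_V π^{-1/2} t^{-1/2} e^{-((‖v‖²+u²)t + m²/(4t))} dv = π^{1/2} t^{-3/2} e^{-(u²t + m²/(4t))}`.
[folklore] -/
theorem yukawaFT_integral_norm (hV : Module.finrank ℝ V = 2) (m u : ℝ) {t : ℝ} (ht : 0 < t) :
    ∫ v : V, ‖(Real.sqrt π)⁻¹ * (t ^ ((1 / 2 : ℝ) - 1) *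
        Real.exp (-((‖v‖ ^ 2 + u ^ 2) * t + (m ^ 2 / 4) / t)))‖ =
      Real.sqrt π * (t ^ ((-(1 / 2) : ℝ) - 1) * Real.exp (-(u ^ 2 * t + (m ^ 2 / 4) / t))) := by
  have h1 : (fun v : V ↦ ‖(Real.sqrt π)⁻¹ * (t ^ ((1 / 2 : ℝ) - 1) *
        Real.exp (-((‖v‖ ^ 2 + u ^ 2) * t + (m ^ 2 / 4) / t)))‖) =
      fun v : V ↦ (Real.sqrt π)⁻¹ * (t ^ ((1 / 2 : ℝ) - 1) *
        Real.exp (-(u ^ 2 * t + (m ^ 2 / 4) / t))) * Real.exp (-(t * ‖v‖ ^ 2)) := by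
    funext v
    rw [Real.norm_of_nonneg (by positivity), yukawaFT_exp_split]
    ring
  rw [h1, integral_const_mul, yukawaFT_integral_gaussian_two hV ht, yukawaFT_weight_mul ht]

/-- **Absolute integrability for Fubini**: the subordination integrand
`(v, t) ↦ π^{-1/2} t^{-1/2} e^{-((‖v‖²+u²)t + m²/(4t))}` is integrable on `V × (0, ∞)` (`m, u > 0`,
`dim V = 2`): its `V`-marginal `π^{1/2} t^{-3/2} e^{-(u²t + m²/(4t))}` is integrable on `(0, ∞)`.
[folklore] -/
theorem yukawaFT_integrable_prod (hV : Module.finrank ℝ V = 2) {m u : ℝ} (hm : 0 < m)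
    (hu : 0 < u) :
    Integrable (Function.uncurry fun (v : V) (t : ℝ) ↦
        (Real.sqrt π)⁻¹ * (t ^ ((1 / 2 : ℝ) - 1) *
          Real.exp (-((‖v‖ ^ 2 + u ^ 2) * t + (m ^ 2 / 4) / t))))
      ((volume : Measure V).prod (volume.restrict (Ioi (0 : ℝ)))) := by
  have hmeas : Measurable (Function.uncurry fun (v : V) (t : ℝ) ↦
      (Real.sqrt π)⁻¹ * (t ^ ((1 / 2 : ℝ) - 1) *
        Real.exp (-((‖v‖ ^ 2 + u ^ 2) * t + (m ^ 2 / 4) / t)))) := by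
    unfold Function.uncurry
    fun_prop
  refine (integrable_prod_iff' hmeas.aestronglyMeasurable).2 ⟨?_, ?_⟩
  · refine (ae_restrict_iff' measurableSet_Ioi).2 (Filter.Eventually.of_forall fun t ht ↦ ?_)
    have ht : (0 : ℝ) < t := ht
    have h1 : (fun v : V ↦ Function.uncurry (fun (v : V) (t : ℝ) ↦
        (Real.sqrt π)⁻¹ * (t ^ ((1 / 2 : ℝ) - 1) *
          Real.exp (-((‖v‖ ^ 2 + u ^ 2) * t + (m ^ 2 / 4) / t)))) (v, t)) =
        fun v : V ↦ (Real.sqrt π)⁻¹ * (t ^ ((1 / 2 : ℝ) - 1) *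
          Real.exp (-(u ^ 2 * t + (m ^ 2 / 4) / t))) * Real.exp (-(t * ‖v‖ ^ 2)) := by
      funext v
      simp only [Function.uncurry_apply_pair]
      rw [yukawaFT_exp_split]
      ring
    rw [h1]
    exact (yukawaFT_integrable_gaussian ht).const_mul _
  · have hI := (integral_rpow_mul_exp_neg_mul_sub_div (A := u ^ 2) (B := m ^ 2 / 4)
      (by positivity) (by positivity) (-(1 / 2))).2
    have hI' : IntegrableOn (fun t : ℝ ↦ Real.sqrt π * (t ^ ((-(1 / 2) : ℝ) - 1) *
        Real.exp (-(u ^ 2 * t + (m ^ 2 / 4) / t)))) (Ioi 0) := hI.const_mul _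
    refine IntegrableOn.congr_fun hI' (fun t ht ↦ ?_) measurableSet_Ioi
    have ht : (0 : ℝ) < t := ht
    simp only [Function.uncurry_apply_pair]
    exact (yukawaFT_integral_norm hV m u ht).symm


/-- The Gaussian Fourier transform in dimension `2`: `𝓕[e^{-t‖·‖²}](w) = (π/t) e^{-π²‖w‖²/t}`
(`t > 0`; Mathlib's `fourier_gaussian_innerProductSpace`). [folklore] -/
theorem yukawaFT_fourier_gaussian_two (hV : Module.finrank ℝ V = 2) {t : ℝ} (ht : 0 < t) (w : V) :
    𝓕 (fun v : V ↦ cexp (-(t : ℂ) * (‖v‖ : ℂ) ^ 2)) w =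
      (((π / t) * Real.exp (-(π ^ 2 * ‖w‖ ^ 2 / t)) : ℝ) : ℂ) := by
  have htre : 0 < ((t : ℂ)).re := by simpa using ht
  rw [fourier_gaussian_innerProductSpace htre w, hV]
  have h1 : ((2 : ℕ) : ℂ) / 2 = 1 := by norm_num
  rw [h1, Complex.cpow_one, Complex.ofReal_mul, Complex.ofReal_exp]
  push_cast
  ring_nf

/-- **The inner (spatial) integral** at fixed `t > 0`:
`∫_V 𝐞(-⟪v,w⟫) π^{-1/2} t^{-1/2} e^{-((‖v‖²+u²)t + m²/(4t))} dv`
`= π^{1/2} t^{-3/2} e^{-(u²t + (m²+(2π‖w‖)²)/(4t))}`. [folklore] -/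
theorem yukawaFT_inner (hV : Module.finrank ℝ V = 2) (m u : ℝ) (w : V) {t : ℝ} (ht : 0 < t) :
    (∫ v : V, 𝐞 (-⟪v, w⟫_ℝ) • ((((Real.sqrt π)⁻¹ * (t ^ ((1 / 2 : ℝ) - 1) *
        Real.exp (-((‖v‖ ^ 2 + u ^ 2) * t + (m ^ 2 / 4) / t))) : ℝ) : ℂ))) =
      ((Real.sqrt π * (t ^ ((-(1 / 2) : ℝ) - 1) *
        Real.exp (-(u ^ 2 * t + ((m ^ 2 + (2 * π * ‖w‖) ^ 2) / 4) / t))) : ℝ) : ℂ) := by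
  set C : ℝ := (Real.sqrt π)⁻¹ * (t ^ ((1 / 2 : ℝ) - 1) *
    Real.exp (-(u ^ 2 * t + (m ^ 2 / 4) / t))) with hC
  have hK : (fun v : V ↦ 𝐞 (-⟪v, w⟫_ℝ) • ((((Real.sqrt π)⁻¹ * (t ^ ((1 / 2 : ℝ) - 1) *
        Real.exp (-((‖v‖ ^ 2 + u ^ 2) * t + (m ^ 2 / 4) / t))) : ℝ) : ℂ))) =
      fun v : V ↦ (C : ℂ) * ((𝐞 (-⟪v, w⟫_ℝ) : ℂ) * cexp (-(t : ℂ) * (‖v‖ : ℂ) ^ 2)) := by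
    funext v
    have h1 : (Real.sqrt π)⁻¹ * (t ^ ((1 / 2 : ℝ) - 1) *
        Real.exp (-((‖v‖ ^ 2 + u ^ 2) * t + (m ^ 2 / 4) / t))) =
        C * Real.exp (-(t * ‖v‖ ^ 2)) := by
      rw [yukawaFT_exp_split, hC]
      ring
    rw [h1, Circle.smul_def, smul_eq_mul, Complex.ofReal_mul, Complex.ofReal_exp]
    push_cast
    ring_nf
  rw [hK, integral_const_mul]
  have hFT := yukawaFT_fourier_gaussian_two hV ht w
  rw [Real.fourier_eq] at hFT
  simp_rw [Circle.smul_def, smul_eq_mul] at hFT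
  rw [hFT, ← Complex.ofReal_mul]
  congr 1
  have hexp : Real.exp (-(u ^ 2 * t + (m ^ 2 / 4) / t)) * Real.exp (-(π ^ 2 * ‖w‖ ^ 2 / t)) =
      Real.exp (-(u ^ 2 * t + ((m ^ 2 + (2 * π * ‖w‖) ^ 2) / 4) / t)) := by
    rw [← Real.exp_add]
    congr 1
    field_simp
    ring
  calc C * (π / t * Real.exp (-(π ^ 2 * ‖w‖ ^ 2 / t)))
      = (C * (π / t)) * Real.exp (-(π ^ 2 * ‖w‖ ^ 2 / t)) := by ring
    _ = Real.sqrt π * (t ^ ((-(1 / 2) : ℝ) - 1) * Real.exp (-(u ^ 2 * t + (m ^ 2 / 4) / t))) *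
          Real.exp (-(π ^ 2 * ‖w‖ ^ 2 / t)) := by rw [hC, yukawaFT_weight_mul ht]
    _ = Real.sqrt π * (t ^ ((-(1 / 2) : ℝ) - 1) * (Real.exp (-(u ^ 2 * t + (m ^ 2 / 4) / t)) *
          Real.exp (-(π ^ 2 * ‖w‖ ^ 2 / t)))) := by ring
    _ = _ := by rw [hexp]


/-! ## The transform -/

/-- **The Sommerfeld–Weyl transform of the centred slice**: for `dim V = 2`, `m, u > 0`,
`𝓕[v ↦ e^{-m√(‖v‖²+u²)}/√(‖v‖²+u²)](w) = 2π e^{-u√(m²+(2π‖w‖)²)}/√(m²+(2π‖w‖)²)`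
(subordination, Fubini, Gaussian transform, and the `μ = -1/2` Laplace-type integral). [folklore] -/
theorem yukawaFT_fourier_zero (hV : Module.finrank ℝ V = 2) {m u : ℝ} (hm : 0 < m) (hu : 0 < u)
    (w : V) :
    𝓕 (fun v : V ↦ ((Real.exp (-(m * Real.sqrt (‖v‖ ^ 2 + u ^ 2))) /
        Real.sqrt (‖v‖ ^ 2 + u ^ 2) : ℝ) : ℂ)) w =
      (((2 * π * Real.exp (-(u * Real.sqrt (m ^ 2 + (2 * π * ‖w‖) ^ 2))) /
        Real.sqrt (m ^ 2 + (2 * π * ‖w‖) ^ 2) : ℝ)) : ℂ) := by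
  -- Step 1: Gaussian subordination of the slice.
  have hfun : (fun v : V ↦ ((Real.exp (-(m * Real.sqrt (‖v‖ ^ 2 + u ^ 2))) /
        Real.sqrt (‖v‖ ^ 2 + u ^ 2) : ℝ) : ℂ)) = fun v : V ↦ ∫ t in Ioi (0 : ℝ),
        ((((Real.sqrt π)⁻¹ * (t ^ ((1 / 2 : ℝ) - 1) *
          Real.exp (-((‖v‖ ^ 2 + u ^ 2) * t + (m ^ 2 / 4) / t))) : ℝ) : ℂ)) := by
    funext v
    rw [integral_complex_ofReal, ← yukawaFT_subordination hm (by positivity)]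
  rw [hfun, Real.fourier_eq]
  -- Step 2: Fubini.
  have hint := yukawaFT_integrable_prod hV hm hu
  have hintC : Integrable (Function.uncurry fun (v : V) (t : ℝ) ↦ 𝐞 (-⟪v, w⟫_ℝ) •
      ((((Real.sqrt π)⁻¹ * (t ^ ((1 / 2 : ℝ) - 1) *
        Real.exp (-((‖v‖ ^ 2 + u ^ 2) * t + (m ^ 2 / 4) / t))) : ℝ) : ℂ)))
      ((volume : Measure V).prod (volume.restrict (Ioi (0 : ℝ)))) := by
    have hintR := hint.ofReal (𝕜 := ℂ)
    refine hintR.mono ?_ ?_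
    · exact (Real.continuous_fourierChar.comp (by fun_prop)).aestronglyMeasurable.smul
        hintR.aestronglyMeasurable
    · filter_upwards with ⟨v, t⟩
      simp only [Function.uncurry_apply_pair, Circle.norm_smul]
      exact le_rfl
  have hswap : (∫ v : V, 𝐞 (-⟪v, w⟫_ℝ) • ∫ t in Ioi (0 : ℝ),
      ((((Real.sqrt π)⁻¹ * (t ^ ((1 / 2 : ℝ) - 1) *
        Real.exp (-((‖v‖ ^ 2 + u ^ 2) * t + (m ^ 2 / 4) / t))) : ℝ) : ℂ))) =
      ∫ t in Ioi (0 : ℝ), ∫ v : V, 𝐞 (-⟪v, w⟫_ℝ) •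
        ((((Real.sqrt π)⁻¹ * (t ^ ((1 / 2 : ℝ) - 1) *
          Real.exp (-((‖v‖ ^ 2 + u ^ 2) * t + (m ^ 2 / 4) / t))) : ℝ) : ℂ)) := by
    refine Eq.trans ?_ (integral_integral_swap hintC)
    congr 1 with v
    simp_rw [Circle.smul_def, integral_smul]
  rw [hswap, setIntegral_congr_fun measurableSet_Ioi
    (fun t (ht : t ∈ Ioi (0 : ℝ)) ↦ yukawaFT_inner hV m u w (Set.mem_Ioi.1 ht)),
    integral_complex_ofReal, integral_const_mul,
    yukawaFT_laplace_neg_half (by positivity) (by positivity)]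
  -- Step 3: the value.
  congr 1
  have hS : 0 < m ^ 2 + (2 * π * ‖w‖) ^ 2 := by positivity
  set S : ℝ := m ^ 2 + (2 * π * ‖w‖) ^ 2 with hSdef
  have h4 : Real.sqrt (S / 4) = Real.sqrt S / 2 := by
    rw [Real.sqrt_div' _ (by norm_num : (0 : ℝ) ≤ 4), show (4 : ℝ) = 2 ^ 2 by norm_num,
      Real.sqrt_sq (by norm_num : (0 : ℝ) ≤ 2)]
  have hAB : Real.sqrt (u ^ 2 * (S / 4)) = u * Real.sqrt S / 2 := by
    rw [Real.sqrt_mul' _ (by positivity), Real.sqrt_sq hu.le, h4]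
    ring
  have hπS : Real.sqrt (π / (S / 4)) = 2 * Real.sqrt π / Real.sqrt S := by
    rw [Real.sqrt_div' _ (by positivity), h4]
    field_simp
  rw [hAB, hπS, show 2 * (u * Real.sqrt S / 2) = u * Real.sqrt S by ring]
  calc Real.sqrt π * (2 * Real.sqrt π / Real.sqrt S * Real.exp (-(u * Real.sqrt S)))
      = 2 * (Real.sqrt π * Real.sqrt π) * Real.exp (-(u * Real.sqrt S)) / Real.sqrt S := by ring
    _ = 2 * π * Real.exp (-(u * Real.sqrt S)) / Real.sqrt S := by
      rw [Real.mul_self_sqrt Real.pi_pos.le]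

/-- **Stub `stub_yukawaSliceFourier` — the Sommerfeld–Weyl transform of one Yukawa slice.**
For a `2`-dimensional real inner-product space `V`, `m > 0`, `u > 0` and `x ∈ V`, the Fourier
transform (Mathlib's `𝓕`, kernel `𝐞(-⟪v, w⟫)`) of the planar slice
`v ↦ e^{-m√(‖v-x‖²+u²)}/√(‖v-x‖²+u²)` is `𝐞(-⟪x, w⟫) · 2π e^{-u√(m²+(2π‖w‖)²)}/√(m²+(2π‖w‖)²)`:
the translation rule `VectorFourier.fourierIntegral_comp_add_right` and `yukawaFT_fourier_zero`.
[folklore] -/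
theorem stub_yukawaSliceFourier :
    ∀ (V : Type) [NormedAddCommGroup V] [InnerProductSpace ℝ V] [FiniteDimensional ℝ V]
      [MeasurableSpace V] [BorelSpace V],
      Module.finrank ℝ V = 2 →
      ∀ (m u : ℝ) (x w : V), 0 < m → 0 < u →
        𝓕 (fun v : V =>
            ((Real.exp (-(m * Real.sqrt (‖v - x‖ ^ 2 + u ^ 2))) /
                Real.sqrt (‖v - x‖ ^ 2 + u ^ 2) : ℝ) : ℂ)) w =
          𝐞 (-⟪x, w⟫_ℝ) •
            (((2 * π * Real.exp (-(u * Real.sqrt (m ^ 2 + (2 * π * ‖w‖) ^ 2))) /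
                Real.sqrt (m ^ 2 + (2 * π * ‖w‖) ^ 2) : ℝ)) : ℂ) := by
  intro V _ _ _ _ _ hV m u x w hm hu
  set F : V → ℂ := fun v ↦ ((Real.exp (-(m * Real.sqrt (‖v‖ ^ 2 + u ^ 2))) /
    Real.sqrt (‖v‖ ^ 2 + u ^ 2) : ℝ) : ℂ) with hF
  have hcomp : (fun v : V ↦ ((Real.exp (-(m * Real.sqrt (‖v - x‖ ^ 2 + u ^ 2))) /
      Real.sqrt (‖v - x‖ ^ 2 + u ^ 2) : ℝ) : ℂ)) = F ∘ fun v ↦ v + -x := by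
    funext v
    simp only [Function.comp_apply, hF, ← sub_eq_add_neg]
  rw [hcomp]
  have key := VectorFourier.fourierIntegral_comp_add_right 𝐞 (volume : Measure V) (innerₗ V) F (-x)
  change VectorFourier.fourierIntegral 𝐞 volume (innerₗ V) (F ∘ fun v ↦ v + -x) w = _
  rw [key]
  simp only [innerₗ_apply_apply, inner_neg_left]
  congr 1
  change 𝓕 F w = _
  exact yukawaFT_fourier_zero hV hm hu w

end Summit.AtomisticToContinuum.Crystallization.Theorems.ChessboardParticlePlanesLjPlaneChessboard
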